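import Literature.NumberTheory.Connes2026.AnnulusValue
import HarnessLib

/-!
# Connes 1999 Thm VII.4, `k = ℚ`, `S = {∞, p}` — the off-shell remainder reduced to its SEPARATED part:
# `1 − Q₀ = Q_in + Q_out + (1 − Q̃)` with a margin shell `Q̃ = Q_{e^{−δ}/p, e^{δ}}`; the two ring pieces are
# handled by the shell machinery and tend to `0`

LABEL (line 1): RH-FREE literature (theorems only; NO definition, NO named fact).  bears_on: LADDER-RH
W-C/W-P (C1 named-fact debt), cell `rh-crit`, sub-cell cc, overflow row O1 — the "annulus road" under
`Connes1999_thm_VII_4_rat`.  WHAT THIS IS NOT: a discharge of the fact; any claim about positivity, Weil's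
criterion or RH.

Sources.  A. Connes, Selecta Math. 5 (1999) [`Connes1999`], §VII Thm 4 and proof (29)–(33) (held text
`paper:arxiv-math_9811068`, p0013).

## What is proved

With `Q₀ = Q_{1/p,1}`, `Q̃ = Q_{e^{−δ}/p, e^{δ}}` (`δ > 0`), `Y_M(m) = P̂⁰_M Q₀ ϑ_{m log p}`:
* `shellProj_mul_shellProj_of_le`, `one_sub_shellProj_eq_add` — `Q_{a,b} Q_{b,c} = 0 = Q_{b,c} Q_{a,b}`,
  `1 − Q₀ = Q_{e^{−δ}/p, 1/p} + Q_{1, e^δ} + (1 − Q̃)`;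
* `tendsto_tsum_inner_ring` — the ring pieces `Σ_i ⟨f_i, ϑ(g) Q_ring Y_M(m) f_i⟩ → 0` (`Q_ring Q₀ = 0`);
* **`Connes1999_thm_VII_4_rat_singleton_of_separated`** — the conclusion of `Connes1999_thm_VII_4_rat` at
  `P = {p}` from (S1) a uniform absolute bound, (S0) basis independence and (S2) the vanishing limit of the
  diagonal series of the SEPARATED remainder `ϑ(g)(1 − Q̃) P̂⁰_M Q₀ ϑ_{m log p}` alone.

No instance, notation or attribute; no `def`.
-/

noncomputable section

open _root_.MeasureTheory Complex Set Filter
open scoped Real Topology ComplexConjugate InnerProductSpace ContDiff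

namespace Literature.NumberTheory.Connes2026

open Literature.NumberTheory.LFunctions Literature.Analysis.OperatorTheory
open Literature.NumberTheory.ConnesConsani
open Literature.NumberTheory.ConnesConsani2024
open Literature.NumberTheory.ConnesConsani2021 hiding cutoffProj cutoffProj_coeFn

/-! ## §1. Shell algebra -/

/-- Adjacent shells are orthogonal: `Q_{a,b} Q_{b,c} = 0` (`a ≤ b ≤ c`). [cite: Connes1999, §VII eq. (12) (arXiv p0013)] -/
theorem shellProj_mul_shellProj_of_le {a b c : ℝ} (hab : a ≤ b) (hbc : b ≤ c) :
    shellProj a b * shellProj b c = 0 := by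
  rw [shellProj_def, shellProj_def, mul_sub, sub_mul, sub_mul, cutoffProj_mul_cutoffProj_of_le hbc,
    cutoffProj_mul_self, cutoffProj_mul_cutoffProj_of_le (hab.trans hbc), cutoffProj_mul_cutoffProj_of_le hab]
  abel

/-- Adjacent shells are orthogonal: `Q_{b,c} Q_{a,b} = 0` (`a ≤ b ≤ c`). [cite: Connes1999, §VII eq. (12) (arXiv p0013)] -/
theorem shellProj_mul_shellProj_of_le' {a b c : ℝ} (hab : a ≤ b) (hbc : b ≤ c) :
    shellProj b c * shellProj a b = 0 := by
  rw [shellProj_def, shellProj_def, mul_sub, sub_mul, sub_mul, cutoffProj_mul_cutoffProj_of_ge hbc,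
    cutoffProj_mul_self, cutoffProj_mul_cutoffProj_of_ge (hab.trans hbc), cutoffProj_mul_cutoffProj_of_ge hab]
  abel

/-- `1 − Q_{b,c} = Q_{a,b} + Q_{c,d} + (1 − Q_{a,d})` (telescoping). [cite: Connes1999, §VII eq. (12) (arXiv p0013)] -/
theorem one_sub_shellProj_eq_add (a b c d : ℝ) :
    (1 : Lp ℂ 2 (volume : Measure ℝ) →L[ℂ] Lp ℂ 2 (volume : Measure ℝ)) - shellProj b c =
      shellProj a b + shellProj c d + (1 - shellProj a d) := by
  rw [shellProj_def, shellProj_def, shellProj_def, shellProj_def]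
  abel

variable (p : ℕ) [hp : Fact p.Prime]

/-! ## §2. The ring pieces tend to `0` -/

omit hp in
/-- **A ring piece vanishes in the limit**: for `0 < a ≤ b` with `Q_{a,b} Q₀ = 0`,
`Σ_i ⟨e_i, ϑ(g) Q_{a,b} P̂⁰_M Q₀ ϑ_{m log p} e_i⟩ → Σ_i ⟨e_i, ϑ(g) Q_{a,b} Q₀ ϑ_{m log p} e_i⟩ = 0`. [cite: Connes1999, §VII proof of Thm 4 eqs. (29)–(33) (arXiv p0013)] -/
theorem tendsto_tsum_inner_ring {g : ℝ → ℂ} (hg : IsWeilTest g) {a b : ℝ} (ha : 0 < a) (hab : a ≤ b)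
    (hQ : shellProj a b * annulusProj p 1 = 0) (m : ℤ) {ι : Type*}
    (e : HilbertBasis ι ℂ (evenPart : Submodule ℂ (Lp ℂ 2 (volume : Measure ℝ)))) :
    Tendsto (fun M : ℝ => ∑' i, ⟪((e i : evenPart) : Lp ℂ 2 (volume : Measure ℝ)),
        (scalingOp g ∘L (shellProj a b ∘L
          (dualCutoffProj ∅ M ∘L (annulusProj p 1 ∘L scalingUnitary (m * Real.log p)))))
          ((e i : evenPart) : Lp ℂ 2 (volume : Measure ℝ))⟫_ℂ) atTop (𝓝 0) := by
  have h := tendsto_tsum_inner_scalingOp_shellProj_dualCutoff hg.1 hg.2 ha hab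
    (annulusProj p 1 ∘L scalingUnitary (m * Real.log p)) e
  have h0 : shellProj a b ∘L (annulusProj p 1 ∘L scalingUnitary (m * Real.log p)) = 0 := by
    rw [← ContinuousLinearMap.comp_assoc]
    change (shellProj a b * annulusProj p 1) ∘L scalingUnitary (m * Real.log p) = 0
    rw [hQ, ContinuousLinearMap.zero_comp]
  rw [h0, ContinuousLinearMap.comp_zero] at h
  simpa only [zero_apply, inner_zero_right, tsum_zero] using h

/-! ## §3. The entry point from the separated remainder -/

/-- **Connes 1999 Thm VII.4 (`k = ℚ`) at `P = {p}` from the SEPARATED remainder alone.**  Fix `δ > 0` and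
`Q̃ = Q_{e^{−δ}/p, e^{δ}} ⊋ Q₀`.  If the diagonal series of `ϑ(g)(1 − Q̃) P̂⁰_M Q₀ ϑ_{m log p}` along Hilbert
bases of `L²(ℝ)_ev` are (S1) absolutely summable with sums bounded uniformly in `(M, m, basis)`, (S0) basis
independent and (S2) tend to `0` as `M → ∞`, then for every Hilbert basis `(b_i)` of `L²(ℝ)_ev`
`Σ_i ⟨b_i|ϑ(g)R_Λ|b_i⟩ − (2g(0) log Λ + arch(g)) → ∫′_{ℚ_p^*} g(|u|)|1−u|⁻¹ d^*u` — the ring pieces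
`Q_{e^{−δ}/p,1/p}`, `Q_{1,e^δ}` of `1 − Q₀` being shell-localised (bounded, basis independent, limit `0` by §2)
and the value (V) being `annulusValue`. [cite: Connes1999, §VII Thm 4 and proof eqs. (29)–(33) (arXiv p0013)] -/
theorem Connes1999_thm_VII_4_rat_singleton_of_separated {g : ℝ → ℂ} (hg : IsWeilTest g) {δ : ℝ} (hδ : 0 < δ)
    {C : ℝ}
    (hS1 : ∀ (M : ℝ) (m : ℤ) (ι : Type) (f : HilbertBasis ι ℂ (evenPart : Submodule ℂ (Lp ℂ 2 (volume : Measure ℝ)))),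
      Summable (fun i => ‖⟪((f i : evenPart) : Lp ℂ 2 (volume : Measure ℝ)),
        (scalingOp g ∘L ((1 - shellProj ((p : ℝ)⁻¹ * Real.exp (-δ)) (Real.exp δ)) ∘L
          (dualCutoffProj ∅ M ∘L (annulusProj p 1 ∘L scalingUnitary (m * Real.log p)))))
          ((f i : evenPart) : Lp ℂ 2 (volume : Measure ℝ))⟫_ℂ‖) ∧
      ∑' i, ‖⟪((f i : evenPart) : Lp ℂ 2 (volume : Measure ℝ)),
        (scalingOp g ∘L ((1 - shellProj ((p : ℝ)⁻¹ * Real.exp (-δ)) (Real.exp δ)) ∘L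
          (dualCutoffProj ∅ M ∘L (annulusProj p 1 ∘L scalingUnitary (m * Real.log p)))))
          ((f i : evenPart) : Lp ℂ 2 (volume : Measure ℝ))⟫_ℂ‖ ≤ C)
    (hS0 : ∀ (M : ℝ) (m : ℤ) (ι : Type) (f : HilbertBasis ι ℂ (evenPart : Submodule ℂ (Lp ℂ 2 (volume : Measure ℝ)))) (ι' : Type)
      (f' : HilbertBasis ι' ℂ (evenPart : Submodule ℂ (Lp ℂ 2 (volume : Measure ℝ)))),
      ∑' i, ⟪((f i : evenPart) : Lp ℂ 2 (volume : Measure ℝ)),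
        (scalingOp g ∘L ((1 - shellProj ((p : ℝ)⁻¹ * Real.exp (-δ)) (Real.exp δ)) ∘L
          (dualCutoffProj ∅ M ∘L (annulusProj p 1 ∘L scalingUnitary (m * Real.log p)))))
          ((f i : evenPart) : Lp ℂ 2 (volume : Measure ℝ))⟫_ℂ =
      ∑' i, ⟪((f' i : evenPart) : Lp ℂ 2 (volume : Measure ℝ)),
        (scalingOp g ∘L ((1 - shellProj ((p : ℝ)⁻¹ * Real.exp (-δ)) (Real.exp δ)) ∘L
          (dualCutoffProj ∅ M ∘L (annulusProj p 1 ∘L scalingUnitary (m * Real.log p)))))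
          ((f' i : evenPart) : Lp ℂ 2 (volume : Measure ℝ))⟫_ℂ)
    (hS2 : ∀ (m : ℤ) (ι : Type) (f : HilbertBasis ι ℂ (evenPart : Submodule ℂ (Lp ℂ 2 (volume : Measure ℝ)))),
      Tendsto (fun M : ℝ => ∑' i, ⟪((f i : evenPart) : Lp ℂ 2 (volume : Measure ℝ)),
        (scalingOp g ∘L ((1 - shellProj ((p : ℝ)⁻¹ * Real.exp (-δ)) (Real.exp δ)) ∘L
          (dualCutoffProj ∅ M ∘L (annulusProj p 1 ∘L scalingUnitary (m * Real.log p)))))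
          ((f i : evenPart) : Lp ℂ 2 (volume : Measure ℝ))⟫_ℂ) atTop (𝓝 0))
    (ι : Type) (b : HilbertBasis ι ℂ (evenPart : Submodule ℂ (Lp ℂ 2 (volume : Measure ℝ)))) :
    (∀ Λ : ℝ, 0 < Λ →
      Summable fun i => diagCoeff g (cutoffR {p} Λ) ((b i : evenPart) : Lp ℂ 2 (volume : Measure ℝ))) ∧
    Tendsto (fun Λ : ℝ =>
        (∑' i, diagCoeff g (cutoffR {p} Λ) ((b i : evenPart) : Lp ℂ 2 (volume : Measure ℝ)))
          - connesSemilocalGeometricSide {p} Λ g)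
      atTop (𝓝 0) := by
  have hp1 : (1 : ℝ) < p := by exact_mod_cast hp.out.one_lt
  have hp0 : (0 : ℝ) < p := by linarith
  have hpi : (0 : ℝ) < (p : ℝ)⁻¹ := inv_pos.mpr hp0
  have hpi1 : (p : ℝ)⁻¹ ≤ 1 := inv_le_one_of_one_le₀ hp1.le
  have heδ : Real.exp (-δ) < 1 := Real.exp_lt_one_iff.mpr (by linarith)
  have heδ' : 1 ≤ Real.exp δ := Real.one_le_exp hδ.le
  -- the two rings `Q_in = Q_{e^{-δ}/p, 1/p}`, `Q_out = Q_{1, e^δ}`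
  have hin : (0 : ℝ) < (p : ℝ)⁻¹ * Real.exp (-δ) := mul_pos hpi (Real.exp_pos _)
  have hin' : (p : ℝ)⁻¹ * Real.exp (-δ) ≤ (p : ℝ)⁻¹ := mul_le_of_le_one_right hpi.le heδ.le
  have hQ0 : annulusProj p 1 = shellProj (p : ℝ)⁻¹ 1 := by rw [annulusProj_eq_shellProj, one_div]
  have hQin : shellProj ((p : ℝ)⁻¹ * Real.exp (-δ)) (p : ℝ)⁻¹ * annulusProj p 1 = 0 := by
    rw [hQ0]; exact shellProj_mul_shellProj_of_le hin' hpi1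
  have hQout : shellProj 1 (Real.exp δ) * annulusProj p 1 = 0 := by
    rw [hQ0]; exact shellProj_mul_shellProj_of_le' hpi1 heδ'
  obtain ⟨Cin, hCin0, hIn⟩ := exists_bound_tsum_norm_inner_scalingOp_shellProj hg.1 hg.2 hin hin'
  obtain ⟨Cout, hCout0, hOut⟩ := exists_bound_tsum_norm_inner_scalingOp_shellProj hg.1 hg.2 one_pos heδ'
  -- abbreviations
  have hYn : ∀ (M : ℝ) (m : ℤ), ‖dualCutoffProj ∅ M ∘L (annulusProj p 1 ∘L scalingUnitary (m * Real.log p))‖ ≤ 1 :=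
    fun M m => norm_family_le_one p M m
  -- the decomposition of the off-shell coefficient
  have hdec : ∀ (M : ℝ) (m : ℤ) (x : Lp ℂ 2 (volume : Measure ℝ)),
      ⟪x, (scalingOp g ∘L ((1 - shellProj (p : ℝ)⁻¹ 1) ∘L (dualCutoffProj ∅ M ∘L (annulusProj p 1 ∘L scalingUnitary (m * Real.log p))))) x⟫_ℂ =
      ⟪x, (scalingOp g ∘L (shellProj ((p : ℝ)⁻¹ * Real.exp (-δ)) (p : ℝ)⁻¹ ∘L (dualCutoffProj ∅ M ∘L (annulusProj p 1 ∘L scalingUnitary (m * Real.log p))))) x⟫_ℂ +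
      ⟪x, (scalingOp g ∘L (shellProj 1 (Real.exp δ) ∘L (dualCutoffProj ∅ M ∘L (annulusProj p 1 ∘L scalingUnitary (m * Real.log p))))) x⟫_ℂ +
      ⟪x, (scalingOp g ∘L ((1 - shellProj ((p : ℝ)⁻¹ * Real.exp (-δ)) (Real.exp δ)) ∘L (dualCutoffProj ∅ M ∘L (annulusProj p 1 ∘L scalingUnitary (m * Real.log p))))) x⟫_ℂ := by
    intro M m x
    rw [one_sub_shellProj_eq_add ((p : ℝ)⁻¹ * Real.exp (-δ)) (p : ℝ)⁻¹ 1 (Real.exp δ),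
      ContinuousLinearMap.add_comp, ContinuousLinearMap.add_comp, ContinuousLinearMap.comp_add,
      ContinuousLinearMap.comp_add]
    simp only [add_apply, inner_add_right]
  refine Connes1999_thm_VII_4_rat_singleton_of_offShell' p hg (C' := Cin + Cout + C) ?_ ?_ ?_ ι b
  · -- (O1)
    intro M m ι' f
    have h1 := hIn (dualCutoffProj ∅ M ∘L (annulusProj p 1 ∘L scalingUnitary (m * Real.log p))) ι' f
    have h2 := hOut (dualCutoffProj ∅ M ∘L (annulusProj p 1 ∘L scalingUnitary (m * Real.log p))) ι' f
    have h3 := hS1 M m ι' f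
    have hb : ∀ i, ‖⟪((f i : evenPart) : Lp ℂ 2 (volume : Measure ℝ)), (scalingOp g ∘L ((1 - shellProj (p : ℝ)⁻¹ 1) ∘L (dualCutoffProj ∅ M ∘L (annulusProj p 1 ∘L scalingUnitary (m * Real.log p))))) ((f i : evenPart) : Lp ℂ 2 (volume : Measure ℝ))⟫_ℂ‖ ≤
        ‖⟪((f i : evenPart) : Lp ℂ 2 (volume : Measure ℝ)), (scalingOp g ∘L (shellProj ((p : ℝ)⁻¹ * Real.exp (-δ)) (p : ℝ)⁻¹ ∘L (dualCutoffProj ∅ M ∘L (annulusProj p 1 ∘L scalingUnitary (m * Real.log p))))) ((f i : evenPart) : Lp ℂ 2 (volume : Measure ℝ))⟫_ℂ‖ + ‖⟪((f i : evenPart) : Lp ℂ 2 (volume : Measure ℝ)), (scalingOp g ∘L (shellProj 1 (Real.exp δ) ∘L (dualCutoffProj ∅ M ∘L (annulusProj p 1 ∘L scalingUnitary (m * Real.log p))))) ((f i : evenPart) : Lp ℂ 2 (volume : Measure ℝ))⟫_ℂ‖ + ‖⟪((f i : evenPart) : Lp ℂ 2 (volume : Measure ℝ)), (scalingOp g ∘L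 ((1 - shellProj ((p : ℝ)⁻¹ * Real.exp (-δ)) (Real.exp δ)) ∘L (dualCutoffProj ∅ M ∘L (annulusProj p 1 ∘L scalingUnitary (m * Real.log p))))) ((f i : evenPart) : Lp ℂ 2 (volume : Measure ℝ))⟫_ℂ‖ := fun i => by
      rw [hdec]
      exact (norm_add_le _ _).trans (add_le_add (norm_add_le _ _) le_rfl)
    have h123 : Summable fun i => ‖⟪((f i : evenPart) : Lp ℂ 2 (volume : Measure ℝ)), (scalingOp g ∘L (shellProj ((p : ℝ)⁻¹ * Real.exp (-δ)) (p : ℝ)⁻¹ ∘L (dualCutoffProj ∅ M ∘L (annulusProj p 1 ∘L scalingUnitary (m * Real.log p))))) ((f i : evenPart) : Lp ℂ 2 (volume : Measure ℝ))⟫_ℂ‖ + ‖⟪((f i : evenPart) : Lp ℂ 2 (volume : Measure ℝ)), (scalingOp g ∘L (shellProj 1 (Real.exp δ) ∘L (dualCutoffProj ∅ M ∘L (annulusProj p 1 ∘L scalingUnitary (m * Real.log p))))) ((f i : evenPart) : Lp ℂ 2 (volume : Measure ℝ))⟫_ℂ‖ + ‖⟪((f i : evenPart) : Lp ℂ 2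 (volume : Measure ℝ)), (scalingOp g ∘L ((1 - shellProj ((p : ℝ)⁻¹ * Real.exp (-δ)) (Real.exp δ)) ∘L (dualCutoffProj ∅ M ∘L (annulusProj p 1 ∘L scalingUnitary (m * Real.log p))))) ((f i : evenPart) : Lp ℂ 2 (volume : Measure ℝ))⟫_ℂ‖ := (h1.1.add h2.1).add h3.1
    have hO : Summable fun i => ‖⟪((f i : evenPart) : Lp ℂ 2 (volume : Measure ℝ)), (scalingOp g ∘L ((1 - shellProj (p : ℝ)⁻¹ 1) ∘L (dualCutoffProj ∅ M ∘L (annulusProj p 1 ∘L scalingUnitary (m * Real.log p))))) ((f i : evenPart) : Lp ℂ 2 (volume : Measure ℝ))⟫_ℂ‖ := by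
      refine Summable.of_norm_bounded h123 fun i => ?_
      rw [norm_norm]
      exact hb i
    refine ⟨hO, ?_⟩
    calc ∑' i, ‖⟪((f i : evenPart) : Lp ℂ 2 (volume : Measure ℝ)), (scalingOp g ∘L ((1 - shellProj (p : ℝ)⁻¹ 1) ∘L (dualCutoffProj ∅ M ∘L (annulusProj p 1 ∘L scalingUnitary (m * Real.log p))))) ((f i : evenPart) : Lp ℂ 2 (volume : Measure ℝ))⟫_ℂ‖
        ≤ ∑' i, (‖⟪((f i : evenPart) : Lp ℂ 2 (volume : Measure ℝ)), (scalingOp g ∘L (shellProj ((p : ℝ)⁻¹ * Real.exp (-δ)) (p : ℝ)⁻¹ ∘L (dualCutoffProj ∅ M ∘L (annulusProj p 1 ∘L scalingUnitary (m * Real.log p))))) ((f i : evenPart) : Lp ℂ 2 (volume : Measure ℝ))⟫_ℂ‖ + ‖⟪((f i : evenPart) : Lp ℂ 2 (volume : Measure ℝ)), (scalingOp g ∘L (shellProj 1 (Real.exp δ) ∘L (dualCutoffProj ∅ M ∘L (annulusProj p 1 ∘L scalingUnitary (m * Real.log p))))) ((f i : evenPart) : Lp ℂ 2 (volume : Measure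 ℝ))⟫_ℂ‖ + ‖⟪((f i : evenPart) : Lp ℂ 2 (volume : Measure ℝ)), (scalingOp g ∘L ((1 - shellProj ((p : ℝ)⁻¹ * Real.exp (-δ)) (Real.exp δ)) ∘L (dualCutoffProj ∅ M ∘L (annulusProj p 1 ∘L scalingUnitary (m * Real.log p))))) ((f i : evenPart) : Lp ℂ 2 (volume : Measure ℝ))⟫_ℂ‖) := Summable.tsum_le_tsum hb hO h123
      _ = (∑' i, ‖⟪((f i : evenPart) : Lp ℂ 2 (volume : Measure ℝ)), (scalingOp g ∘L (shellProj ((p : ℝ)⁻¹ * Real.exp (-δ)) (p : ℝ)⁻¹ ∘L (dualCutoffProj ∅ M ∘L (annulusProj p 1 ∘L scalingUnitary (m * Real.log p))))) ((f i : evenPart) : Lp ℂ 2 (volume : Measure ℝ))⟫_ℂ‖) + (∑' i, ‖⟪((f i : evenPart) : Lp ℂ 2 (volume : Measure ℝ)), (scalingOp g ∘L (shellProj 1 (Real.exp δ) ∘L (dualCutoffProj ∅ M ∘L (annulusProj p 1 ∘L scalingUnitary (m * Real.log p))))) ((f i : evenPart) : Lp ℂ 2 (volume : Measure ℝ))⟫_ℂ‖)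 + ∑' i, ‖⟪((f i : evenPart) : Lp ℂ 2 (volume : Measure ℝ)), (scalingOp g ∘L ((1 - shellProj ((p : ℝ)⁻¹ * Real.exp (-δ)) (Real.exp δ)) ∘L (dualCutoffProj ∅ M ∘L (annulusProj p 1 ∘L scalingUnitary (m * Real.log p))))) ((f i : evenPart) : Lp ℂ 2 (volume : Measure ℝ))⟫_ℂ‖ := by
          rw [(h1.1.add h2.1).tsum_add h3.1, h1.1.tsum_add h2.1]
      _ ≤ Cin * ‖(dualCutoffProj ∅ M ∘L (annulusProj p 1 ∘L scalingUnitary (m * Real.log p)))‖ + Cout * ‖(dualCutoffProj ∅ M ∘L (annulusProj p 1 ∘L scalingUnitary (m * Real.log p)))‖ + C := add_le_add (add_le_add h1.2 h2.2) h3.2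
      _ ≤ Cin + Cout + C := by nlinarith [hYn M m, hCin0, hCout0, norm_nonneg (dualCutoffProj ∅ M ∘L (annulusProj p 1 ∘L scalingUnitary (m * Real.log p)))]
  · -- (O0)
    intro M m ι' f ι'' f'
    have h1 := hIn (dualCutoffProj ∅ M ∘L (annulusProj p 1 ∘L scalingUnitary (m * Real.log p))) ι' f
    have h2 := hOut (dualCutoffProj ∅ M ∘L (annulusProj p 1 ∘L scalingUnitary (m * Real.log p))) ι' f
    have h3 := hS1 M m ι' f
    have h1' := hIn (dualCutoffProj ∅ M ∘L (annulusProj p 1 ∘L scalingUnitary (m * Real.log p))) ι'' f'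
    have h2' := hOut (dualCutoffProj ∅ M ∘L (annulusProj p 1 ∘L scalingUnitary (m * Real.log p))) ι'' f'
    have h3' := hS1 M m ι'' f'
    simp_rw [hdec]
    rw [((Summable.of_norm h1.1).add (Summable.of_norm h2.1)).tsum_add (Summable.of_norm h3.1),
      (Summable.of_norm h1.1).tsum_add (Summable.of_norm h2.1),
      ((Summable.of_norm h1'.1).add (Summable.of_norm h2'.1)).tsum_add (Summable.of_norm h3'.1),
      (Summable.of_norm h1'.1).tsum_add (Summable.of_norm h2'.1),
      tsum_inner_scalingOp_shellProj_eq_of_hilbertBasis hg.1 hg.2 hin hin' ((dualCutoffProj ∅ M ∘L (annulusProj p 1 ∘L scalingUnitary (m * Real.log p)))) f f',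
      tsum_inner_scalingOp_shellProj_eq_of_hilbertBasis hg.1 hg.2 one_pos heδ' ((dualCutoffProj ∅ M ∘L (annulusProj p 1 ∘L scalingUnitary (m * Real.log p)))) f f', hS0 M m ι' f ι'' f']
  · -- (O2)
    intro m ι' f
    have hlim1 := tendsto_tsum_inner_ring p hg hin hin' hQin m f
    have hlim2 := tendsto_tsum_inner_ring p hg one_pos heδ' hQout m f
    have hlim3 := hS2 m ι' f
    have h := (hlim1.add hlim2).add hlim3
    rw [add_zero, add_zero] at h
    refine h.congr' (Eventually.of_forall fun M => ?_)
    have h1 := hIn (dualCutoffProj ∅ M ∘L (annulusProj p 1 ∘L scalingUnitary (m * Real.log p))) ι' f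
    have h2 := hOut (dualCutoffProj ∅ M ∘L (annulusProj p 1 ∘L scalingUnitary (m * Real.log p))) ι' f
    have h3 := hS1 M m ι' f
    simp_rw [hdec]
    rw [((Summable.of_norm h1.1).add (Summable.of_norm h2.1)).tsum_add (Summable.of_norm h3.1),
      (Summable.of_norm h1.1).tsum_add (Summable.of_norm h2.1)]

end Literature.NumberTheory.Connes2026
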